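import Summits.CriticalPhenomena.PercolationContinuityZ3.Theses.PercNearOneGluing
import Summits.CriticalPhenomena.PercolationContinuityZ3.Theorems.PercNearOneGluingAdditiveGluingTieLiftTwoAux
import Summits.CriticalPhenomena.PercolationContinuityZ3.Theorems.PercNearOneGluingAdditiveGluingPartial
import Literature.Probability.Percolation.PercolationProofs
import HarnessLib

/-!
# Crux `PercNearOneGluing.AdditiveGluing` (stmt-CriticalPhenomena-4576), line `replica-splice-at-entrance` —
# stub `stub_tieLiftTwo`: the tie reduction, second half (two lifted pairs)

Helper file for the crux (lead prover-line-stmt-CriticalPhenomena-4576-c3): proves exactly the registered stub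
signature `stub_tieLiftTwo`; lands with `--supports stmt-CriticalPhenomena-4576`; it does NOT close the crux.

## Statement

If the additive gluing inequality `P(o ↔ A) − t ≤ P(o ↔ b)` (`0 ≤ t`, `P(a ↔ b) ≥ 1 − t` on `A`) holds on every
finite weighted graph whenever THREE distinct relays attain the slack exactly (`P(aᵢ ↔ b) = 1 − t`, `i < 3`),
then it holds whenever TWO distinct relays `a₀ ≠ a₁` do.

## Proof (the lead's paper proof; Kozma–Nitzan, arXiv:2401.12397, §5.3 "move the weight of an edge")

Cases: a third relay attains `t` — the hypothesis; `A ⊆ {a₀, a₁}` — the landed two-relay theorem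
`additiveGluing_of_card_le_two` (`…AdditiveGluingPartial.lean`); otherwise every other relay is strictly better,
so `t > 0` and `a₀, a₁ ≠ b`.  Then (`tieLiftTwo_lift`) lower the weights of BOTH pairs `e₀ = s(a₀,b)`,
`e₁ = s(a₁,b)` jointly along `y ↦ w_y := w[e₀ ↦ 1 − αy][e₁ ↦ 1 − βy]`, `α = 1 − w e₀`, `β = 1 − w e₁`,
`y ∈ [0,1]`, `w_1 = w`:

* every `P_{w_y}(S)` is bi-affine in the two weights (`tieLiftTwo_twoBond_decomp`), hence a quadratic
  polynomial in `y`; the failure probabilities `F_a(y) = 1 − P_{w_y}(a ↔ b)` are continuous;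
* the tie persists: `F_{a₀}(y) − F_{a₁}(y)` is linear in `y` (`tieLiftTwo_tie_linear`) and vanishes at `y = 1`;
* `G(y) := F_{a₀}(y) − max_{a ∉ {a₀,a₁}} F_a(y)` is continuous, `G(1) > 0`, `G(0) ≤ 0` (`F_{a₀}(0) = 0`), so
  it vanishes at some `y* < 1` (intermediate value theorem), where three relays attain `t* := F_{a₀}(y*)`
  and the hypothesis gives `Ψ(y*) ≤ 0` for `Ψ(y) := P_{w_y}(o ↔ A) − P_{w_y}(o ↔ b) − F_{a₀}(y)`;
* `Ψ` is a quadratic, so `ȳ (Ψ(1) − Ψ(y*)) = (1 − y*) (2Ψ(w_ȳ) − Ψ(w_ȳ[e₀↦1]) − Ψ(w_ȳ[e₁↦1]))` with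
  `ȳ = (1 + y*)/2` (exact midpoint rule), and the bracket is `≤ 0` by the convexity step
  `tieLiftTwo_convex_step` (Kozma–Nitzan Thm 1 for the tied pair `{a₀, a₁}` in E-form); hence
  `Ψ(1) ≤ Ψ(y*) ≤ 0`, which is the claim.
-/

namespace Summit.CriticalPhenomena.PercolationContinuityZ3.Theorems

open MeasureTheory Set
open Literature.Probability.LatticeModels Literature.Probability.Percolation

noncomputable section

variable {n : ℕ}

/-! ### The joint lift of the two tied pairs -/

/-- **The two-pair lift** (core of `stub_tieLiftTwo`): if additive gluing holds whenever three distinct relays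
attain the slack exactly, `a₀ ≠ a₁` are two relays of `A` (both `≠ b`) with `P(a₀ ↔ b) = P(a₁ ↔ b) = 1 − t`,
and every other relay of `A` (there is at least one) has `P(a ↔ b) > 1 − t`, then
`P(o ↔ A) − t ≤ P(o ↔ b)`.  See the module docstring for the proof. [folklore] -/
theorem tieLiftTwo_lift
    (hT3 : ∀ (n : ℕ) (w : Sym2 (Fin n) → unitInterval) (A : Finset (Fin n)) (o b : Fin n) (t : ℝ), 0 ≤ t →
        (∀ a ∈ A, 1 - t ≤ (prodBernoulli w).real (openConn a b)) →
        (∃ a₀ ∈ A, ∃ a₁ ∈ A, ∃ a₂ ∈ A, a₀ ≠ a₁ ∧ a₀ ≠ a₂ ∧ a₁ ≠ a₂ ∧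
          (prodBernoulli w).real (openConn a₀ b) = 1 - t ∧ (prodBernoulli w).real (openConn a₁ b) = 1 - t ∧
          (prodBernoulli w).real (openConn a₂ b) = 1 - t) →
        (prodBernoulli w).real (⋃ a ∈ A, openConn o a) - t ≤ (prodBernoulli w).real (openConn o b))
    (w : Sym2 (Fin n) → unitInterval) (A : Finset (Fin n)) (o b a₀ a₁ : Fin n) (t : ℝ)
    (h₀ : a₀ ∈ A) (h₁ : a₁ ∈ A) (h01 : a₀ ≠ a₁) (hb₀ : a₀ ≠ b) (hb₁ : a₁ ≠ b)
    (hP₀ : (prodBernoulli w).real (openConn a₀ b) = 1 - t)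
    (hP₁ : (prodBernoulli w).real (openConn a₁ b) = 1 - t)
    (hRne : (A \ {a₀, a₁}).Nonempty)
    (hR : ∀ a ∈ A \ {a₀, a₁}, 1 - t < (prodBernoulli w).real (openConn a b)) :
    (prodBernoulli w).real (⋃ a ∈ A, openConn o a) - t ≤ (prodBernoulli w).real (openConn o b) := by
  have hne : s(a₀, b) ≠ s(a₁, b) := by rw [Ne, Sym2.congr_left]; exact h01
  -- the lift parameters `α = 1 − w e₀`, `β = 1 − w e₁`
  obtain ⟨α, hα⟩ : ∃ α : ℝ, α = 1 - ((w s(a₀, b) : unitInterval) : ℝ) := ⟨_, rfl⟩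
  obtain ⟨β, hβ⟩ : ∃ β : ℝ, β = 1 - ((w s(a₁, b) : unitInterval) : ℝ) := ⟨_, rfl⟩
  have hα0 : 0 ≤ α := by rw [hα]; linarith [(w s(a₀, b)).2.2]
  have hα1 : α ≤ 1 := by rw [hα]; linarith [(w s(a₀, b)).2.1]
  have hβ0 : 0 ≤ β := by rw [hβ]; linarith [(w s(a₁, b)).2.2]
  have hβ1 : β ≤ 1 := by rw [hβ]; linarith [(w s(a₁, b)).2.1]
  have hwα : ((w s(a₀, b) : unitInterval) : ℝ) = 1 - α := by rw [hα]; ring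
  have hwβ : ((w s(a₁, b) : unitInterval) : ℝ) = 1 - β := by rw [hβ]; ring
  have hbα : ∀ y : ℝ, 0 ≤ y → y ≤ 1 → 0 ≤ 1 - α * y ∧ 1 - α * y ≤ 1 := fun y hy0 hy1 =>
    ⟨by nlinarith [mul_le_mul hα1 hy1 hy0 zero_le_one], by nlinarith [mul_nonneg hα0 hy0]⟩
  have hbβ : ∀ y : ℝ, 0 ≤ y → y ≤ 1 → 0 ≤ 1 - β * y ∧ 1 - β * y ≤ 1 := fun y hy0 hy1 =>
    ⟨by nlinarith [mul_le_mul hβ1 hy1 hy0 zero_le_one], by nlinarith [mul_nonneg hβ0 hy0]⟩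
  -- the two-parameter family `W p q = w[e₀ ↦ p][e₁ ↦ q]` and the clamp `cI : ℝ → [0, 1]`
  obtain ⟨W, hW⟩ : ∃ W : unitInterval → unitInterval → (Sym2 (Fin n) → unitInterval),
      W = fun p q => Function.update (Function.update w s(a₀, b) p) s(a₁, b) q := ⟨_, rfl⟩
  obtain ⟨cI, hcI⟩ : ∃ cI : ℝ → unitInterval, cI = Set.projIcc (0:ℝ) 1 zero_le_one := ⟨_, rfl⟩
  have hcIv : ∀ x : ℝ, 0 ≤ x → x ≤ 1 → ((cI x : unitInterval) : ℝ) = x := fun x hx0 hx1 => by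
    rw [hcI, Set.projIcc_of_mem _ ⟨hx0, hx1⟩]
  have hcI1 : cI 1 = 1 := by
    rw [hcI, Set.projIcc_of_mem _ ⟨zero_le_one, le_rfl⟩]; rfl
  have hWw : W (w s(a₀, b)) (w s(a₁, b)) = w := by
    simp only [hW, Function.update_eq_self]
  have hWy1 : W (cI (1 - α * 1)) (cI (1 - β * 1)) = w := by
    have h1 : cI (1 - α * 1) = w s(a₀, b) := by rw [mul_one, ← hwα, hcI, Set.projIcc_val]
    have h2 : cI (1 - β * 1) = w s(a₁, b) := by rw [mul_one, ← hwβ, hcI, Set.projIcc_val]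
    rw [h1, h2, hWw]
  have hWe₀ : ∀ p q : unitInterval, W p q s(a₀, b) = p := fun p q => by
    simp only [hW]; rw [Function.update_of_ne hne, Function.update_self]
  -- bi-affine decomposition along the family
  have hdec : ∀ (p q : unitInterval) (S : Set (BondConfig (Fin n))), (prodBernoulli (W p q)).real S =
      (1 - (p : ℝ)) * (1 - (q : ℝ)) * (prodBernoulli (W 0 0)).real S +
        (p : ℝ) * (1 - (q : ℝ)) * (prodBernoulli (W 1 0)).real S +
        (1 - (p : ℝ)) * (q : ℝ) * (prodBernoulli (W 0 1)).real S +
        (p : ℝ) * (q : ℝ) * (prodBernoulli (W 1 1)).real S := by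
    intro p q S; rw [hW]; exact tieLiftTwo_twoBond_decomp w hne p q S
  -- the clamped coordinates of the path `y ↦ (1 − α y, 1 − β y)`
  obtain ⟨Pf, hPf⟩ : ∃ Pf : ℝ → ℝ, Pf = fun y => ((cI (1 - α * y) : unitInterval) : ℝ) := ⟨_, rfl⟩
  obtain ⟨Qf, hQf⟩ : ∃ Qf : ℝ → ℝ, Qf = fun y => ((cI (1 - β * y) : unitInterval) : ℝ) := ⟨_, rfl⟩
  have hPc : Continuous Pf := by
    rw [hPf, hcI]; exact continuous_subtype_val.comp (continuous_projIcc.comp (by fun_prop))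
  have hQc : Continuous Qf := by
    rw [hQf, hcI]; exact continuous_subtype_val.comp (continuous_projIcc.comp (by fun_prop))
  -- failure functions `F a y = 1 − P_{W(y)}(a ↔ b)`, as explicit polynomials in `Pf y, Qf y`
  obtain ⟨F, hF⟩ : ∃ F : Fin n → ℝ → ℝ, F = fun a y =>
      1 - ((1 - Pf y) * (1 - Qf y) * (prodBernoulli (W 0 0)).real (openConn a b) +
        Pf y * (1 - Qf y) * (prodBernoulli (W 1 0)).real (openConn a b) +
        (1 - Pf y) * Qf y * (prodBernoulli (W 0 1)).real (openConn a b) +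
        Pf y * Qf y * (prodBernoulli (W 1 1)).real (openConn a b)) := ⟨_, rfl⟩
  have hFW : ∀ (a : Fin n) (y : ℝ),
      (prodBernoulli (W (cI (1 - α * y)) (cI (1 - β * y)))).real (openConn a b) = 1 - F a y := by
    intro a y; rw [hdec]; simp only [hF, hPf, hQf]; ring
  have hFc : ∀ a, Continuous (F a) := fun a => by simp only [hF]; fun_prop
  have hF0 : ∀ a y, 0 ≤ F a y := fun a y => by
    have h := hFW a y
    have h1 : (prodBernoulli (W (cI (1 - α * y)) (cI (1 - β * y)))).real (openConn a b) ≤ 1 :=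
      measureReal_le_one
    linarith
  have hFa1 : ∀ a, F a 1 = 1 - (prodBernoulli w).real (openConn a b) := fun a => by
    have h := hFW a 1; rw [hWy1] at h; linarith
  have hF00 : F a₀ 0 = 0 := by
    have h := hFW a₀ 0
    rw [mul_zero, mul_zero, sub_zero, hcI1] at h
    have h1 : (prodBernoulli (W 1 1)).real (openConn a₀ b) = 1 :=
      tieLiftTwo_real_conn_eq_one _ hb₀ (hWe₀ 1 1)
    linarith
  -- the tie persists along the lift: `F a₀ = F a₁` on `[0, 1]`
  have hlin : ∀ p q : unitInterval, (1 - (prodBernoulli (W p q)).real (openConn a₀ b)) -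
      (1 - (prodBernoulli (W p q)).real (openConn a₁ b)) =
      (1 - (p : ℝ)) * (1 - (prodBernoulli (W 0 0)).real (openConn a₀ b ∪ openConn a₀ a₁)) -
      (1 - (q : ℝ)) * (1 - (prodBernoulli (W 0 0)).real (openConn a₁ b ∪ openConn a₁ a₀)) := by
    intro p q; rw [hW]; exact tieLiftTwo_tie_linear w h01 hb₀ hb₁ p q
  have hK : ∀ y : ℝ, 0 ≤ y → y ≤ 1 → F a₀ y - F a₁ y =
      y * (α * (1 - (prodBernoulli (W 0 0)).real (openConn a₀ b ∪ openConn a₀ a₁)) -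
        β * (1 - (prodBernoulli (W 0 0)).real (openConn a₁ b ∪ openConn a₁ a₀))) := by
    intro y hy0 hy1
    have h := hlin (cI (1 - α * y)) (cI (1 - β * y))
    rw [hFW a₀ y, hFW a₁ y, hcIv _ (hbα y hy0 hy1).1 (hbα y hy0 hy1).2,
      hcIv _ (hbβ y hy0 hy1).1 (hbβ y hy0 hy1).2] at h
    linear_combination h
  have hK0 : α * (1 - (prodBernoulli (W 0 0)).real (openConn a₀ b ∪ openConn a₀ a₁)) -
      β * (1 - (prodBernoulli (W 0 0)).real (openConn a₁ b ∪ openConn a₁ a₀)) = 0 := by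
    have h1 := hK 1 zero_le_one le_rfl
    rw [hFa1, hFa1, hP₀, hP₁] at h1
    linarith
  have htie : ∀ y : ℝ, 0 ≤ y → y ≤ 1 → F a₀ y = F a₁ y := by
    intro y hy0 hy1
    have h := hK y hy0 hy1
    rw [hK0, mul_zero, sub_eq_zero] at h
    exact h
  -- the gap to the best other relay and the intermediate value theorem
  obtain ⟨g, hg⟩ : ∃ g : ℝ → ℝ, g = fun y => F a₀ y - (A \ {a₀, a₁}).sup' hRne (fun a => F a y) := ⟨_, rfl⟩
  have hgc : Continuous g := by
    rw [hg]; exact (hFc a₀).sub (Continuous.finset_sup'_apply hRne fun a _ => hFc a)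
  have hg1 : 0 < g 1 := by
    have h : (A \ {a₀, a₁}).sup' hRne (fun a => F a 1) < F a₀ 1 := by
      rw [Finset.sup'_lt_iff]
      intro a ha
      rw [hFa1, hFa1, hP₀]
      linarith [hR a ha]
    simp only [hg]; linarith
  have hg0 : g 0 ≤ 0 := by
    obtain ⟨a', ha'⟩ := id hRne
    have h3 : F a' 0 ≤ (A \ {a₀, a₁}).sup' hRne (fun a => F a 0) := Finset.le_sup' (fun a => F a 0) ha'
    simp only [hg]
    linarith [hF0 a' 0]
  obtain ⟨ys, hys, hgys⟩ : ∃ ys ∈ Icc (0:ℝ) 1, g ys = 0 :=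
    intermediate_value_Icc zero_le_one hgc.continuousOn ⟨hg0, hg1.le⟩
  have hys1 : ys < 1 := lt_of_le_of_ne hys.2 (fun h => by rw [h] at hgys; linarith)
  -- a third relay `a₂` catches up at `ys`
  have hgys' : F a₀ ys = (A \ {a₀, a₁}).sup' hRne (fun a => F a ys) := by
    simp only [hg] at hgys; linarith
  obtain ⟨a₂, ha₂, ha₂eq⟩ := Finset.exists_mem_eq_sup' hRne (fun a => F a ys)
  obtain ⟨ha₂A, ha₂ne⟩ := Finset.mem_sdiff.1 ha₂
  rw [Finset.mem_insert, Finset.mem_singleton, not_or] at ha₂ne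
  have hall : ∀ a ∈ A, F a ys ≤ F a₀ ys := by
    intro a ha
    by_cases ha0 : a = a₀
    · rw [ha0]
    by_cases ha1 : a = a₁
    · rw [ha1, htie ys hys.1 hys.2]
    have hmem : a ∈ A \ {a₀, a₁} := Finset.mem_sdiff.2 ⟨ha, by simp [ha0, ha1]⟩
    rw [hgys']; exact Finset.le_sup' (fun a => F a ys) hmem
  -- the three-tie hypothesis at `W(ys)` with slack `t* = F a₀ ys`
  have happ := hT3 n (W (cI (1 - α * ys)) (cI (1 - β * ys))) A o b (F a₀ ys) (hF0 a₀ ys)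
    (fun a ha => by rw [hFW]; linarith [hall a ha])
    ⟨a₀, h₀, a₁, h₁, a₂, ha₂A, h01, fun h => ha₂ne.1 h.symm, fun h => ha₂ne.2 h.symm,
      by rw [hFW], by rw [hFW, htie ys hys.1 hys.2], by rw [hFW, ← ha₂eq, hgys']⟩
  -- the functional `Ψ` and its bi-affine structure
  obtain ⟨Ψ, hΨ⟩ : ∃ Ψ : (Sym2 (Fin n) → unitInterval) → ℝ, Ψ = fun v =>
      (prodBernoulli v).real (⋃ a ∈ A, openConn o a) - (prodBernoulli v).real (openConn o b) -
        (1 - (prodBernoulli v).real (openConn a₀ b)) := ⟨_, rfl⟩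
  have hΨdec : ∀ p q : unitInterval, Ψ (W p q) =
      (1 - (p : ℝ)) * (1 - (q : ℝ)) * Ψ (W 0 0) + (p : ℝ) * (1 - (q : ℝ)) * Ψ (W 1 0) +
        (1 - (p : ℝ)) * (q : ℝ) * Ψ (W 0 1) + (p : ℝ) * (q : ℝ) * Ψ (W 1 1) := by
    intro p q; simp only [hΨ]; rw [hW]; exact tieLiftTwo_psi_decomp w hne _ _ _ p q
  have hΨys : Ψ (W (cI (1 - α * ys)) (cI (1 - β * ys))) ≤ 0 := by
    simp only [hΨ]; have h := hFW a₀ ys; linarith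
  -- the midpoint `ȳ` and the convexity step there
  obtain ⟨yb, hyb⟩ : ∃ yb : ℝ, yb = (1 + ys) / 2 := ⟨_, rfl⟩
  have hyb0 : 0 ≤ yb := by rw [hyb]; linarith [hys.1]
  have hyb1 : yb ≤ 1 := by rw [hyb]; linarith
  have hconv : 2 * Ψ (W (cI (1 - α * yb)) (cI (1 - β * yb))) ≤
      Ψ (W 1 (cI (1 - β * yb))) + Ψ (W (cI (1 - α * yb)) 1) := by
    have htb : (prodBernoulli (W (cI (1 - α * yb)) (cI (1 - β * yb)))).real (openConn a₀ b) ≤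
        (prodBernoulli (W (cI (1 - α * yb)) (cI (1 - β * yb)))).real (openConn a₁ b) := by
      rw [hFW, hFW, htie yb hyb0 hyb1]
    have h := tieLiftTwo_convex_step (W (cI (1 - α * yb)) (cI (1 - β * yb))) A o b a₀ a₁ h₀ h₁ hb₀ hb₁ htb
    have hW10 : Function.update (W (cI (1 - α * yb)) (cI (1 - β * yb))) s(a₀, b) 1 =
        W 1 (cI (1 - β * yb)) := by
      simp only [hW]; rw [Function.update_comm (Ne.symm hne), Function.update_idem]
    have hW01 : Function.update (W (cI (1 - α * yb)) (cI (1 - β * yb))) s(a₁, b) 1 =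
        W (cI (1 - α * yb)) 1 := by
      simp only [hW]; rw [Function.update_idem]
    rw [hW10, hW01] at h
    simp only [hΨ]; linarith
  -- exact midpoint rule for the quadratic `Ψ`: `ȳ (Ψ(1) − Ψ(ys)) = (1 − ys) · (convexity bracket at ȳ)`
  have hkey : yb * (Ψ (W (w s(a₀, b)) (w s(a₁, b))) - Ψ (W (cI (1 - α * ys)) (cI (1 - β * ys)))) =
      (1 - ys) * (2 * Ψ (W (cI (1 - α * yb)) (cI (1 - β * yb))) -
        Ψ (W 1 (cI (1 - β * yb))) - Ψ (W (cI (1 - α * yb)) 1)) := by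
    rw [hΨdec (w s(a₀, b)) (w s(a₁, b)), hΨdec (cI (1 - α * ys)) (cI (1 - β * ys)),
      hΨdec (cI (1 - α * yb)) (cI (1 - β * yb)), hΨdec 1 (cI (1 - β * yb)), hΨdec (cI (1 - α * yb)) 1,
      hwα, hwβ, hcIv _ (hbα ys hys.1 hys.2).1 (hbα ys hys.1 hys.2).2,
      hcIv _ (hbβ ys hys.1 hys.2).1 (hbβ ys hys.1 hys.2).2,
      hcIv _ (hbα yb hyb0 hyb1).1 (hbα yb hyb0 hyb1).2, hcIv _ (hbβ yb hyb0 hyb1).1 (hbβ yb hyb0 hyb1).2,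
      Set.Icc.coe_one, hyb]
    ring
  -- conclude: `Ψ(w) ≤ Ψ(ys) ≤ 0`
  have hfin : Ψ w ≤ 0 := by
    have h1 : (1 - ys) * (2 * Ψ (W (cI (1 - α * yb)) (cI (1 - β * yb))) -
        Ψ (W 1 (cI (1 - β * yb))) - Ψ (W (cI (1 - α * yb)) 1)) ≤ 0 :=
      mul_nonpos_iff.2 (Or.inl ⟨by linarith [hys.2], by linarith [hconv]⟩)
    rw [← hkey, hWw] at h1
    have hybpos : 0 < yb := by rw [hyb]; linarith [hys.1]
    have h2 : Ψ w - Ψ (W (cI (1 - α * ys)) (cI (1 - β * ys))) ≤ 0 := by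
      by_contra h3
      push Not at h3
      linarith [mul_pos hybpos h3]
    linarith [hΨys]
  simp only [hΨ] at hfin
  linarith [hP₀]

/-! ### The registered stub -/

/-- Registered stub `stub_tieLiftTwo` of crux stmt-CriticalPhenomena-4576 (line replica-splice-at-entrance):
**if additive gluing holds whenever three distinct relays attain the slack `t` exactly, then it holds whenever
two distinct relays do.**  Cases: a third relay attains `t` (the hypothesis); `A ⊆ {a₀, a₁}`
(`additiveGluing_of_card_le_two`); otherwise `t > 0`, `a₀, a₁ ≠ b`, and `tieLiftTwo_lift`. [folklore] -/
theorem stub_tieLiftTwo :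
    (∀ (n : ℕ) (w : Sym2 (Fin n) → unitInterval) (A : Finset (Fin n)) (o b : Fin n) (t : ℝ), 0 ≤ t →
        (∀ a ∈ A, 1 - t ≤ (prodBernoulli w).real (openConn a b)) →
        (∃ a₀ ∈ A, ∃ a₁ ∈ A, ∃ a₂ ∈ A, a₀ ≠ a₁ ∧ a₀ ≠ a₂ ∧ a₁ ≠ a₂ ∧ (prodBernoulli w).real (openConn a₀ b) = 1 - t ∧ (prodBernoulli w).real (openConn a₁ b) = 1 - t ∧ (prodBernoulli w).real (openConn a₂ b) = 1 - t) →
        (prodBernoulli w).real (⋃ a ∈ A, openConn o a) - t ≤ (prodBernoulli w).real (openConn o b)) →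
      (∀ (n : ℕ) (w : Sym2 (Fin n) → unitInterval) (A : Finset (Fin n)) (o b : Fin n) (t : ℝ), 0 ≤ t →
        (∀ a ∈ A, 1 - t ≤ (prodBernoulli w).real (openConn a b)) →
        (∃ a₀ ∈ A, ∃ a₁ ∈ A, a₀ ≠ a₁ ∧ (prodBernoulli w).real (openConn a₀ b) = 1 - t ∧ (prodBernoulli w).real (openConn a₁ b) = 1 - t) →
        (prodBernoulli w).real (⋃ a ∈ A, openConn o a) - t ≤ (prodBernoulli w).real (openConn o b)) := by
  intro hT3 n w A o b t ht hA hex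
  obtain ⟨a₀, h₀, a₁, h₁, h01, hP₀, hP₁⟩ := hex
  -- a third relay attaining the slack: the hypothesis applies directly
  by_cases h3 : ∃ a₂ ∈ A, a₂ ≠ a₀ ∧ a₂ ≠ a₁ ∧ (prodBernoulli w).real (openConn a₂ b) = 1 - t
  · obtain ⟨a₂, h₂, h20, h21, hP₂⟩ := h3
    exact hT3 n w A o b t ht hA
      ⟨a₀, h₀, a₁, h₁, a₂, h₂, h01, fun h => h20 h.symm, fun h => h21 h.symm, hP₀, hP₁, hP₂⟩
  push Not at h3
  -- at most the two tied relays: the landed two-relay theorem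
  by_cases hRne : (A \ {a₀, a₁}).Nonempty
  swap
  · rw [Finset.not_nonempty_iff_eq_empty, Finset.sdiff_eq_empty_iff_subset] at hRne
    exact additiveGluing_of_card_le_two n w A o b t ((Finset.card_le_card hRne).trans Finset.card_le_two) ht hA
  -- every other relay is strictly better; hence `t > 0`, so `a₀ ≠ b` and `a₁ ≠ b`
  have hR : ∀ a ∈ A \ {a₀, a₁}, 1 - t < (prodBernoulli w).real (openConn a b) := by
    intro a ha
    obtain ⟨haA, hane⟩ := Finset.mem_sdiff.1 ha
    rw [Finset.mem_insert, Finset.mem_singleton, not_or] at hane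
    exact lt_of_le_of_ne (hA a haA) (fun h => h3 a haA hane.1 hane.2 h.symm)
  have htpos : 0 < t := by
    obtain ⟨a, ha⟩ := hRne
    have h := hR a ha
    have h1 : (prodBernoulli w).real (openConn a b) ≤ 1 := measureReal_le_one
    linarith
  have hbb : (prodBernoulli w).real (openConn b b) = 1 := by
    have huniv : (openConn b b : Set (BondConfig (Fin n))) = Set.univ :=
      Set.eq_univ_of_forall fun _ => SimpleGraph.Reachable.refl _
    rw [huniv, probReal_univ]
  have hb₀ : a₀ ≠ b := by
    rintro rfl
    rw [hbb] at hP₀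
    linarith
  have hb₁ : a₁ ≠ b := by
    rintro rfl
    rw [hbb] at hP₁
    linarith
  exact tieLiftTwo_lift hT3 w A o b a₀ a₁ t h₀ h₁ h01 hb₀ hb₁ hP₀ hP₁ hRne hR

end

end Summit.CriticalPhenomena.PercolationContinuityZ3.Theorems
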